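import Literature.NumberTheory.EllipticCurves.LangHeightSzpiroRatio
import Literature.NumberTheory.EllipticCurves.HeightsProofs
import Literature.NumberTheory.DiophantineGeometry.EllArithGlueProofs
import Literature.NumberTheory.DiophantineGeometry.MinimalDiscriminantProofs
import Literature.NumberTheory.DiophantineGeometry.MinimalDiscriminantFiniteProofs
import HarnessLib

/-!
# Szpiro ⇒ Lang's height lower bound over `ℚ`: the assembly (Petsche 2006 / Hindry–Silverman 1988)

Sibling proof file of `LangHeightEC.lean` / `LangHeightSzpiroRatio.lean` (topic
`NumberTheory/EllipticCurves`, family `abc`, G06). It proves the two *assembly* layers of the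
printed proof of the named fact
`Literature.NumberTheory.EllipticCurves.szpiro_imp_langHeightLowerBoundConjecture`
("Szpiro ⇒ Lang's height lower bound over `ℚ`"; Hindry–Silverman, Invent. Math. 93 (1988),
Thm. 0.3 and the remark after Conj. 0.4; Silverman, AEC 2nd ed., Thm. VIII.9.10(b)), following
C. Petsche, *Small rational points on elliptic curves over number fields*, New York J. Math. 12
(2006), 257–268 (arXiv math/0508160):

* `Petsche2006_langHeightLowerBound_of_card_smallPoints_le`: **Theorem 2 from Proposition 7**
  over `ℚ` (Petsche, "Proof of Theorems 1 and 2", p. 265): the multiples `O, P, …, ⌊A⌋P` of a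
  non-torsion point of small height are `⌊A⌋ + 1 > A` distinct small points;
* `exists_szpiroRatio_mem_Icc_of_szpiro`: Szpiro's conjecture with one fixed exponent confines the
  Szpiro ratio of every `E/ℚ` to an interval `[1, σ₀]` (AEC, footnote 1 on p. 219);
* `langHeightLowerBoundConjecture_of_szpiro`, `szpiro_imp_langHeightLowerBoundConjecture_of`:
  **Theorem 2 ⇒ (Szpiro ⇒ Lang)**, with Lang's constant `c = 2 c(1, σ₀)` in the tree's normalisation
  of `ĥ` (twice Silverman's), using the bridge `N(𝔇_min) = |Δ_min|` for globally minimal equations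
  (`WeierstrassCurve.minimalDiscriminantNorm_int_eq_natAbs_minimalDiscriminantInt_holds`);
* `szpiro_imp_langHeightLowerBoundConjecture_of_card_smallPoints_le`: the target fact conditional on
  the **single** remaining named fact `Petsche2006_card_smallPoints_le` (Petsche's Proposition 7,
  the bound on the number of small rational points), whose printed proof is the place-by-place
  estimate of Néron local heights (Petsche Lemmas 3–5, local decomposition ATAEC VI.2.1, see
  `NeronLocalHeight.lean`) — not yet available in Mathlib or `Literature/`.

Everything else used is proved in the tree: quadraticity and non-negativity of `ĥ`
(`HeightsProofs`), `N_E ≥ 1`, `N(𝔇_min) ≥ 1`, `N_E ∣ N(𝔇_min)` (`Conductor`, `MinimalDiscriminant*Proofs`).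

## Design notes

* No new definitions; pure proofs (`--kind proof`). Namespace = path (`Literature.NumberTheory.EllipticCurves`),
  numerical lemmas about Petsche's constants in the existing sub-namespace `Petsche2006`.
* `canonicalHeight_nsmul_rat`: the generic number-field fact `canonicalHeight_nsmul` is stated for the
  group law elaborated with the classical `DecidableEq K`; over `ℚ` instance resolution picks
  `instDecidableEqRat`, and the two instances agree by `Subsingleton.elim` (`convert`).
* Degenerate values of Petsche's constants (`σ = 0`, `log(c₂σ²) = 0`, where Lean's `1/0 = 0`) never
  occur (`σ ≥ 1` is proved where needed) but are handled uniformly in the numerical lemma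
  `Petsche2006.countBound_sq_mul_langConstant_le`.

## References

* C. Petsche, *Small rational points on elliptic curves over number fields*, New York J. Math. 12
  (2006), 257–268; arXiv math/0508160: Theorem 2, Proposition 7, Proof of Theorems 1 and 2.
* M. Hindry, J. H. Silverman, *The canonical height and integral points on elliptic curves*,
  Invent. Math. 93 (1988), 419–450: Theorem 0.3, Conjecture 0.4 and the remark following it.
* J. H. Silverman, *The Arithmetic of Elliptic Curves*, GTM 106, 2nd ed. (2009): Conjecture VIII.9.9,
  Theorem VIII.9.10(b) with footnote 1 (pp. 218–219), Conjecture VIII.11.1.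
-/

noncomputable section

open scoped Classical

open IsDedekindDomain

namespace Literature.NumberTheory.EllipticCurves

open WeierstrassCurve WeierstrassCurve.Affine.Point Petsche2006

/-! ### Numerical facts about Petsche's constants -/

namespace Petsche2006

/-- The numerical inequality behind "`ĥ(P) > M⁻² (log N(Δ))/(2¹³ 3 d σ²) ≥ c(d,σ) log N(Δ)`" in
Petsche's proof of Theorem 2 (p. 265): `c₁² · 2¹³ · 3 = 4.47·10¹⁴ ≤ 10¹⁵`. [folklore] -/
theorem c₁_sq_mul_le : c₁ ^ 2 * (2 ^ 13 * 3) ≤ (10 : ℝ) ^ 15 := by norm_num [c₁]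

/-- `log (c₂ σ²) > 0` for `σ ≥ 1`. [folklore] -/
theorem log_c₂_mul_sq_pos {σ : ℝ} (hσ : 1 ≤ σ) : 0 < Real.log (c₂ * 1 * σ ^ 2) := by
  apply Real.log_pos
  have h1 : (1 : ℝ) ≤ σ ^ 2 := by nlinarith
  have hc₂ : (1 : ℝ) < c₂ := by norm_num [c₂]
  nlinarith

/-- The key comparison of Petsche's two bounds at `d = 1`: `(count bound)² · c(1,σ) ≤ 1/(2¹³·3·σ²)`,
i.e. `M ≤ c₁σ² log(c₂σ²)` points of height `≤ (log N(Δ))/(2¹³ 3 σ²)` force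
`ĥ(P) ≥ c(1,σ) log N(Δ)` (Petsche 2006, end of the proof of Thm. 2). Degenerate values (`σ = 0` or
`log(c₂σ²) = 0`, where Lean's `1/0 = 0` makes `c(1,σ) = 0`) are covered as well. [folklore] -/
theorem countBound_sq_mul_langConstant_le (σ : ℝ) :
    countBound 1 σ ^ 2 * langConstant 1 σ ≤ 1 / (2 ^ 13 * 3 * 1 * σ ^ 2) := by
  unfold countBound langConstant
  set ℓ := Real.log (c₂ * 1 * σ ^ 2) with hℓ
  by_cases hσ : σ = 0
  · subst hσ
    simp
  by_cases hℓ0 : ℓ = 0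
  · rw [hℓ0]
    simp only [mul_zero, ne_eq, OfNat.ofNat_ne_zero, not_false_eq_true, zero_pow, mul_one,
      one_pow, div_zero]
    positivity
  have hσ2 : 0 < σ ^ 2 := by positivity
  have key : (c₁ * 1 * σ ^ 2 * ℓ) ^ 2 * (1 / (10 ^ 15 * 1 ^ 3 * σ ^ 6 * ℓ ^ 2)) =
      c₁ ^ 2 / ((10 : ℝ) ^ 15 * σ ^ 2) := by
    field_simp
  rw [key, div_le_div_iff₀ (by positivity) (by positivity)]
  nlinarith [c₁_sq_mul_le, hσ2]

/-- `c(1, ·)` is antitone on `[1, ∞)`: `1 ≤ σ ≤ τ ⟹ c(1,τ) ≤ c(1,σ)`. [folklore] -/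
theorem langConstant_antitone {σ τ : ℝ} (hσ : 1 ≤ σ) (h : σ ≤ τ) :
    langConstant 1 τ ≤ langConstant 1 σ := by
  unfold langConstant
  have hℓσ := log_c₂_mul_sq_pos hσ
  have hℓτ := log_c₂_mul_sq_pos (hσ.trans h)
  have hc₂ : (1 : ℝ) < c₂ := by norm_num [c₂]
  apply one_div_le_one_div_of_le (by positivity)
  have h0σ : 0 ≤ σ := zero_le_one.trans hσ
  have hlog : Real.log (c₂ * 1 * σ ^ 2) ≤ Real.log (c₂ * 1 * τ ^ 2) :=
    Real.log_le_log (by positivity) (by gcongr)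
  gcongr

/-- `c(1, σ) > 0` for `σ ≥ 1`. [folklore] -/
theorem langConstant_pos {σ : ℝ} (hσ : 1 ≤ σ) : 0 < langConstant 1 σ := by
  unfold langConstant
  have hℓσ := log_c₂_mul_sq_pos hσ
  positivity

end Petsche2006

/-! ### Petsche 2006, Theorem 2 from Proposition 7 -/

section Rat

variable {W : WeierstrassCurve ℚ} [W.IsElliptic]

/-- Quadraticity `ĥ(mP) = m² ĥ(P)` over `ℚ` (Silverman AEC VIII.9.3(b), discharged in
`HeightsProofs`), restated for the group law on `E(ℚ)` elaborated with `ℚ`'s decidable equality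
(the generic number-field statement uses the classical instance; the two `DecidableEq ℚ` instances
are equal by `Subsingleton.elim`). [folklore] -/
theorem canonicalHeight_nsmul_rat (m : ℕ) (P : W.toAffine.Point) :
    (m • P).canonicalHeight = (m : ℝ) ^ 2 * P.canonicalHeight := by
  convert canonicalHeight_nsmul_holds m P

end Rat

/-- **Petsche 2006, Theorem 2 from Proposition 7** (over `ℚ`), following the printed proof
(New York J. Math. 12 (2006), p. 265, "Proof of Theorems 1 and 2"): if `P` is non-torsion and
`ĥ(P) < c(1,σ) log N(Δ)`, then the `⌊A⌋ + 1` multiples `O, P, 2P, …, ⌊A⌋P`, `A = c₁σ² log(c₂σ²)`,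
are pairwise distinct and all satisfy `ĥ(mP) = m² ĥ(P) ≤ A² c(1,σ) log N(Δ) ≤ log N(Δ)/(2¹³ 3 σ²)`
(quadraticity of `ĥ`, AEC VIII.9.3(b), and `c₁² 2¹³ 3 ≤ 10¹⁵`), contradicting Proposition 7, which
allows at most `A` such points. [cite: Petsche2006, Thm. 2] -/
theorem Petsche2006_langHeightLowerBound_of_card_smallPoints_le
    (h : Petsche2006_card_smallPoints_le) : Petsche2006_langHeightLowerBound := by
  intro W _ P hP
  obtain ⟨hfin, hcard⟩ := h W
  set σ := W.szpiroRatio ℤ with hσ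
  set L := Real.log (W.minimalDiscriminantNorm ℤ : ℝ) with hL
  set A := countBound 1 σ with hA
  set B := smallHeightBound 1 σ L with hB
  set S := {Q : W.toAffine.Point | Q.canonicalHeight / 2 ≤ B} with hS
  have hL0 : 0 ≤ L :=
    Real.log_nonneg (by exact_mod_cast minimalDiscriminantNorm_pos_holds W)
  have hB0 : 0 ≤ B := by
    rw [hB, smallHeightBound]
    positivity
  have h0 : 0 ≤ P.canonicalHeight := canonicalHeight_nonneg_holds P
  by_contra hlt
  push Not at hlt
  -- every multiple `m • P`, `m ≤ ⌊A⌋₊`, lies in `S`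
  have hsmall : ∀ m : ℕ, m ≤ ⌊A⌋₊ → m • P ∈ S := by
    intro m hm
    rw [hS, Set.mem_setOf_eq, canonicalHeight_nsmul_rat m P]
    rcases lt_or_ge A 0 with hA0 | hA0
    · have hm0 : m = 0 := by
        rw [Nat.floor_of_nonpos hA0.le] at hm
        omega
      subst hm0
      simpa using hB0
    · have hmA : (m : ℝ) ≤ A := (Nat.cast_le.mpr hm).trans (Nat.floor_le hA0)
      calc (m : ℝ) ^ 2 * P.canonicalHeight / 2 = (m : ℝ) ^ 2 * (P.canonicalHeight / 2) := by ring
        _ ≤ A ^ 2 * (langConstant 1 σ * L) := by gcongr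
        _ = (A ^ 2 * langConstant 1 σ) * L := by ring
        _ ≤ (1 / (2 ^ 13 * 3 * 1 * σ ^ 2)) * L := by
          gcongr
          exact countBound_sq_mul_langConstant_le σ
        _ = B := by rw [hB, smallHeightBound]; ring
  -- the multiples are pairwise distinct
  have hinj : Function.Injective fun m : ℕ => m • P :=
    injective_nsmul_iff_not_isOfFinAddOrder.mpr hP
  set T : Finset W.toAffine.Point := (Finset.range (⌊A⌋₊ + 1)).image fun m : ℕ => m • P with hT
  have hTcard : T.card = ⌊A⌋₊ + 1 := by
    rw [hT, Finset.card_image_of_injective _ hinj, Finset.card_range]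
  have hTS : (T : Set W.toAffine.Point) ⊆ S := by
    intro Q hQ
    rw [hT, Finset.coe_image] at hQ
    obtain ⟨m, hm, rfl⟩ := hQ
    exact hsmall m (Nat.lt_succ_iff.mp (Finset.mem_range.mp hm))
  have h1 : ((⌊A⌋₊ + 1 : ℕ) : ℝ) ≤ S.ncard := by
    have := Set.ncard_le_ncard hTS hfin
    rw [Set.ncard_coe_finset, hTcard] at this
    exact_mod_cast this
  have h2 : (S.ncard : ℝ) ≤ A := hcard
  have h3 : A < ⌊A⌋₊ + 1 := Nat.lt_floor_add_one A
  push_cast at h1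
  linarith

/-! ### Szpiro's conjecture bounds the Szpiro ratio -/

/-- Under Szpiro's conjecture (with the single exponent `6 + 1`), the Szpiro ratio of every
elliptic curve over `ℚ` lies in a fixed interval `[1, σ₀]`: if `N > 1` then `N ∣ N(𝔇)` gives
`σ ≥ 1`, and `N(𝔇) ≤ κ N⁷` gives `σ ≤ 7 + log κ / log 2`; if `N = 1` then `σ = 1` by convention.
(Silverman, AEC 2nd ed., footnote 1 on p. 219: "it suffices to assume … that Szpiro's conjecture
is true for some fixed exponent".) [cite: SilvermanAEC2009, Thm VIII.9.10(b)] -/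
theorem exists_szpiroRatio_mem_Icc_of_szpiro (hS : SzpiroConjecture) :
    ∃ σ₀ : ℝ, 1 ≤ σ₀ ∧ ∀ (W : WeierstrassCurve ℚ) [W.IsElliptic],
      1 ≤ W.szpiroRatio ℤ ∧ W.szpiroRatio ℤ ≤ σ₀ := by
  obtain ⟨C, hC⟩ := hS 1 one_pos
  set C' := max C 1 with hC'
  have hC'1 : 1 ≤ C' := le_max_right _ _
  have hC'0 : 0 < C' := one_pos.trans_le hC'1
  have hlogC' : 0 ≤ Real.log C' := Real.log_nonneg hC'1
  have hlog2 : 0 < Real.log 2 := Real.log_pos one_lt_two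
  have hσ₀ : (1 : ℝ) ≤ 7 + Real.log C' / Real.log 2 := by
    have : 0 ≤ Real.log C' / Real.log 2 := div_nonneg hlogC' hlog2.le
    linarith
  refine ⟨7 + Real.log C' / Real.log 2, hσ₀, fun W _ => ?_⟩
  by_cases h1 : 1 < W.conductorNorm ℤ
  · rw [szpiroRatio_of_one_lt_conductorNorm _ _ h1]
    have hNpos : 0 < W.conductorNorm ℤ := conductorNorm_pos_holds W
    have hDpos : 0 < W.minimalDiscriminantNorm ℤ := minimalDiscriminantNorm_pos_holds W
    have hdvd : W.conductorNorm ℤ ∣ W.minimalDiscriminantNorm ℤ :=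
      conductorNorm_dvd_minimalDiscriminantNorm W
        (finite_setOf_ordMinimalDiscriminant_ne_zero_holds W)
    set N : ℝ := (W.conductorNorm ℤ : ℝ) with hN
    set D : ℝ := (W.minimalDiscriminantNorm ℤ : ℝ) with hD
    have hN2 : (2 : ℝ) ≤ N := by rw [hN]; exact_mod_cast h1
    have hN0 : (0 : ℝ) < N := by linarith
    have hD0 : (0 : ℝ) < D := by rw [hD]; exact_mod_cast hDpos
    have hND : N ≤ D := by rw [hN, hD]; exact_mod_cast Nat.le_of_dvd hDpos hdvd
    have hlogN : 0 < Real.log N := Real.log_pos (by linarith)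
    have hSz : D ≤ C' * N ^ ((6 : ℝ) + 1) :=
      (hC W).trans (mul_le_mul_of_nonneg_right (le_max_left _ _) (by positivity))
    constructor
    · rw [le_div_iff₀ hlogN, one_mul]
      exact Real.log_le_log hN0 hND
    · rw [div_le_iff₀ hlogN]
      have hlogD : Real.log D ≤ Real.log C' + 7 * Real.log N := by
        calc Real.log D ≤ Real.log (C' * N ^ ((6 : ℝ) + 1)) := Real.log_le_log hD0 hSz
          _ = Real.log C' + ((6 : ℝ) + 1) * Real.log N := by
            rw [Real.log_mul hC'0.ne' (by positivity), Real.log_rpow hN0]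
          _ = Real.log C' + 7 * Real.log N := by norm_num
      have hlog2N : Real.log 2 ≤ Real.log N := Real.log_le_log two_pos hN2
      have hCle : Real.log C' ≤ Real.log C' / Real.log 2 * Real.log N := by
        rw [div_mul_eq_mul_div, le_div_iff₀ hlog2]
        exact mul_le_mul_of_nonneg_left hlog2N hlogC'
      nlinarith
  · push Not at h1
    rw [szpiroRatio_of_conductorNorm_le_one _ _ h1]
    exact ⟨le_rfl, hσ₀⟩

/-! ### The assembly -/

/-- **Szpiro ⇒ Lang over `ℚ`, from Petsche's Theorem 2** (Petsche 2006, p. 258: "A consequence of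
Theorem 2 is that Szpiro's conjecture implies Lang's conjecture; this fact was originally proved by
Hindry–Silverman"; Silverman, AEC 2nd ed., Thm. VIII.9.10(b) with footnote 1). Proof: Szpiro's
conjecture with the fixed exponent `7` confines the Szpiro ratio to `[1, σ₀]`
(`exists_szpiroRatio_mem_Icc_of_szpiro`), `c(1,σ)` is antitone there, so Theorem 2 gives
`ĥ(P)/2 ≥ c(1,σ₀) log N(𝔇_min)`; finally `N(𝔇_min) = |Δ_min|` for a globally minimal equation
(`minimalDiscriminantNorm_int_eq_natAbs_minimalDiscriminantInt_holds`), so Lang's conjecture holds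
with `c = 2 c(1,σ₀)` in the tree's normalisation of `ĥ`. [cite: Petsche2006, Thm. 2] -/
theorem langHeightLowerBoundConjecture_of_szpiro (h : Petsche2006_langHeightLowerBound)
    (hS : SzpiroConjecture) : LangHeightLowerBoundConjecture := by
  obtain ⟨σ₀, hσ₀, hσ⟩ := exists_szpiroRatio_mem_Icc_of_szpiro hS
  refine ⟨2 * langConstant 1 σ₀, by positivity [langConstant_pos hσ₀], fun W _ _ P hP => ?_⟩
  obtain ⟨h1, h2⟩ := hσ W
  have hP' := h W P hP
  have hL : 0 ≤ Real.log (W.minimalDiscriminantNorm ℤ : ℝ) :=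
    Real.log_nonneg (by exact_mod_cast minimalDiscriminantNorm_pos_holds W)
  have hmono := langConstant_antitone h1 h2
  have hbridge : |(minimalDiscriminantInt W : ℝ)| = (W.minimalDiscriminantNorm ℤ : ℝ) := by
    rw [minimalDiscriminantNorm_int_eq_natAbs_minimalDiscriminantInt_holds W, Nat.cast_natAbs,
      Int.cast_abs]
  rw [hbridge]
  nlinarith

/-- **Szpiro ⇒ Lang over `ℚ`** (`szpiro_imp_langHeightLowerBoundConjecture`, Hindry–Silverman 1988,
Thm. 0.3 with the remark following Conj. 0.4), conditional on Petsche's Theorem 2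
(`Petsche2006_langHeightLowerBound`). [cite: Petsche2006, Thm. 2] -/
theorem szpiro_imp_langHeightLowerBoundConjecture_of (h : Petsche2006_langHeightLowerBound) :
    szpiro_imp_langHeightLowerBoundConjecture := fun hS =>
  langHeightLowerBoundConjecture_of_szpiro h hS

/-- **Szpiro ⇒ Lang over `ℚ`** (`szpiro_imp_langHeightLowerBoundConjecture`), conditional on the single
named fact `Petsche2006_card_smallPoints_le` (Petsche 2006, Prop. 7: the bound on the number of
small rational points, whose printed proof is the local-height estimate place by place).
[cite: Petsche2006, Prop. 7] -/
theorem szpiro_imp_langHeightLowerBoundConjecture_of_card_smallPoints_le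
    (h : Petsche2006_card_smallPoints_le) : szpiro_imp_langHeightLowerBoundConjecture :=
  szpiro_imp_langHeightLowerBoundConjecture_of
    (Petsche2006_langHeightLowerBound_of_card_smallPoints_le h)

end Literature.NumberTheory.EllipticCurves

end
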